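import Summits.ABC.ABC.Theorems.CongruentialReceptacleReceptacleIdentityStubStableSzpiroOfTLR
import Summits.ABC.ABC.Theorems.CongruentialReceptacleReceptacleIdentityStubPhiEqLinGain

/-!
# The typed face of crux `ReceptacleIdentity` is FALSE modulo a residue-matched free lunch

Negative lemma of line `stable-szpiro-duality` (crux stmt-ABC-1813, lead prover-line-stmt-ABC-1813-a1-0,
2026-08-17): the composition of the checked skeleton `Cruxes/ReceptacleIdentity/Lines/stable_szpiro_duality.lean`
with every stub but the creative one landed —

* A1 `stub_stableSzpiroAt_of_tameLocalReceptacleAt` (p134656): the crux's body at one `(κ, ε)` implies STABLE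
  SZPIRO at `(κ, ε)`, `Φ(∂F) ≤ c₃ ‖F‖₁` for every signed family of `κ`-balanced abc-triples (congruence read as
  equality at a prime-power modulus above the family);
* linearity `stub_phi_eq_linGain_of_matched` (p134795): on residue-MATCHED families `Φ(∂F) = c₁ · Σ_T w_T s_T`,
  `s_T = 2 log(abc) − (6+ε) log rad(abc)`.

Hence ONE residue-matched signed family of unbounded gain ratio at ONE `(κ, ε)` — `MatchedFreeLunch κ ε` of the
Defs file — refutes `Summit.ABC.ABC.Theses.CongruentialReceptacle.TameLocalReceptacle` (stmt-ABC-14354, the typed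
face of the informal crux stmt-ABC-1813) for all constants.  Landed `--negative-modulo MatchedFreeLunchHypothesis`;
the crux item stays open until the hypothesis is constructed (the line's `stub_matchedFreeLunch`).  The pointwise
form `not_stableSzpiroAt_of_matchedFreeLunch` / `not_tameLocalReceptacleAt_of_matchedFreeLunch` is what a template
at a specific `(κ, ε)` plugs into.
-/

-- `Summit.<Summit>.<Problem>` is the mandated summit-side namespace (CONVENTIONS §2); for the
-- single-conjunct summit `ABC` the two coincide, so the duplicate `ABC.ABC` is deliberate.
set_option linter.dupNamespace false

namespace Summit.ABC.ABC.Theorems.StableSzpiro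

open Summit.ABC.ABC.Theses.CongruentialReceptacle

/-- **The hypothesis of the negative lemma** (`H` of `--negative-modulo`): at some balance `κ > 0` and some
`ε > 0` there are residue-MATCHED signed families of `κ`-balanced abc-triples of unbounded gain ratio
`Σ_T w_T s_T / ‖F‖₁` — the creative stub `stub_matchedFreeLunch` of line `stable-szpiro-duality`, verbatim.
A construction, not a published statement; hence a hypothesis, not a Literature fact. -/
def MatchedFreeLunchHypothesis : Prop :=
  ∃ κ : ℝ, 0 < κ ∧ ∃ ε : ℝ, 0 < ε ∧ MatchedFreeLunch κ ε

/-- **Pointwise form**: a matched free lunch at `(κ, ε)` refutes Stable Szpiro at the same `(κ, ε)` —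
evaluate `Φ` on the matched family by linearity and beat the ratio `c₃ / c₁`. [folklore] -/
theorem not_stableSzpiroAt_of_matchedFreeLunch {κ ε : ℝ} (h : MatchedFreeLunch κ ε) :
    ¬ StableSzpiroAt κ ε := by
  rintro ⟨c₁, c₁', c₃, hc₁, hSS⟩
  obtain ⟨F, hM, hlt⟩ := h (c₃ / c₁)
  have hle : Phi c₁ c₁' ε F.bdry ≤ c₃ * F.l1 := hSS F
  rw [stub_phi_eq_linGain_of_matched κ c₁ c₁' ε F hM] at hle
  have hmul : c₁ * (c₃ / c₁ * F.l1) < c₁ * F.linGain ε := mul_lt_mul_of_pos_left hlt hc₁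
  have hc : c₁ * (c₃ / c₁ * F.l1) = c₃ * F.l1 := by
    field_simp
  linarith

/-- **Pointwise form on the crux's body**: a matched free lunch at `(κ, ε)` refutes the tame-local
receptacle at the same `(κ, ε)` (A1 then the previous lemma). [folklore] -/
theorem not_tameLocalReceptacleAt_of_matchedFreeLunch {κ ε : ℝ} (h : MatchedFreeLunch κ ε) :
    ¬ TameLocalReceptacleAt κ ε := fun hT =>
  not_stableSzpiroAt_of_matchedFreeLunch h (stub_stableSzpiroAt_of_tameLocalReceptacleAt κ ε hT)

/-- **The typed crux is false modulo a matched free lunch** (negative lemma of line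
`stable-szpiro-duality`): `MatchedFreeLunchHypothesis → ¬ TameLocalReceptacle`. [folklore] -/
theorem TameLocalReceptacle_false_of_MatchedFreeLunchHypothesis :
    MatchedFreeLunchHypothesis → ¬ TameLocalReceptacle := by
  rintro ⟨κ, hκ, ε, hε, hFL⟩ hT
  exact not_tameLocalReceptacleAt_of_matchedFreeLunch hFL (tameLocalReceptacle_iff.mp hT κ hκ ε hε)

end Summit.ABC.ABC.Theorems.StableSzpiro
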